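import Literature.Computability.Cryptography.RegevReductionStepSplit
import Literature.Computability.Cryptography.RegevSamplerDualSize
import Literature.Computability.Cryptography.RegevSamplerWidth
import HarnessLib

/-!
# Regev 2009, Lemma 3.14 in machine form: the sizes of the stage quantities

Topic `Literature/Computability/Cryptography`, grouping namespace `Regev2009.SamplerRegs`; sequel of
`RegevSamplerWidth.lean` and `RegevSamplerWindows.lean`. Regev's proof of Lemma 3.14 chooses the grid
"fine enough": "all quantities are at most `2^{poly(n)}`, so polynomially many bits suffice". The windows of
`RegevSamplerWindows.lean` ask for exponents `j, A, j₀, …` with `2^j ≤ D_t ≤ 2^A`, `2|t|√n ≤ 2^{j₀}`, …; this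
file bounds the instance-dependent quantities by powers of two whose exponents are polynomial in the code
lengths, so that such exponents exist uniformly in the input length:

* rationals: `|r| ≤ 2^{|code r|}` and `2^{-|code r|} ≤ |r|` for `r ≠ 0` (`abs_cast_le_two_pow`,
  `two_pow_inv_le_abs_cast`);
* the determinant: `|det B| ≤ n!·2^{n|code B|} ≤ 2^{2n|code B|}` (`detA_le`, `detA_le_two_pow`, Hadamard–Leibniz);
* the step ratio: `1 ≤ θ(n)` once `√n ≤ a(n)q(n)` and `θ(n) ≤ 2q(n)` for `0 ≤ a(n) ≤ 1`
  (`one_le_stepRatio`, `stepRatio_le_two_mul`); the level radii `r ≤ ρ_k ≤ Θ^L r` (`le_levelRadius`,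
  `levelRadius_le_pow_mul`);
* the stage width `t = √2 ρ √n/(aq)`: `ρ/(aq) ≤ t ≤ ρ` for `aq ≥ 2√n` (`div_le_tW`, `tW_le_self`), whence the
  window `2^{-(L_r + b_q)} ≤ t ≤ 2^{(b_q+1)L + L_r}` (`tW_window`).

Everything here is proved; no named fact is introduced.

## References

* O. Regev, *On lattices, learning with errors, random linear codes, and cryptography*, J. ACM 56 (2009),
  art. 34, Lemma 3.14 (proof), Theorem 3.1 (proof) [Regev2009].
* D. Micciancio, S. Goldwasser, *Complexity of Lattice Problems*, Kluwer 2002, Ch. 1 §1.1–1.2 [MicciancioGoldwasser2002].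
-/

noncomputable section

namespace Literature.Computability.Cryptography

namespace Regev2009

namespace SamplerRegs

open Literature.Algebra.EuclideanLattices Literature.Algebra.EuclideanLattices.Regev2009 SamplerArith QCircuit
open scoped Real

/-! ### Rationals are `2^{|code|}`-bounded -/

/-- `|num r| < 2^{|code r|}`. [folklore] -/
theorem natAbs_num_lt_two_pow (r : ℚ) : r.num.natAbs < 2 ^ (encodeRat r).length := by
  refine lt_of_lt_of_le (Nat.lt_size_self _) (Nat.pow_le_pow_right (by norm_num) ?_)
  rw [Complexity.CodeFP.length_encodeRat]; omega

/-- `den r < 2^{|code r|}`. [folklore] -/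
theorem den_lt_two_pow (r : ℚ) : r.den < 2 ^ (encodeRat r).length := by
  refine lt_of_lt_of_le (Nat.lt_size_self _) (Nat.pow_le_pow_right (by norm_num) ?_)
  rw [Complexity.CodeFP.length_encodeRat]; omega

/-- `|r|·den r = |num r|` over `ℝ`. [folklore] -/
theorem abs_cast_mul_den (r : ℚ) : |(r : ℝ)| * r.den = (r.num.natAbs : ℝ) := by
  have h : (r : ℝ) * r.den = (r.num : ℝ) := by exact_mod_cast Rat.mul_den_eq_num r
  have hd : (0 : ℝ) ≤ r.den := Nat.cast_nonneg _
  rw [← abs_of_nonneg hd, ← abs_mul, h, ← Int.cast_abs, Int.abs_eq_natAbs, Int.cast_natCast]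

/-- **`|r| ≤ 2^{|code r|}`.** [folklore] -/
theorem abs_cast_le_two_pow (r : ℚ) : |(r : ℝ)| ≤ (2 : ℝ) ^ (encodeRat r).length := by
  have hd : (1 : ℝ) ≤ r.den := by exact_mod_cast r.den_pos
  calc |(r : ℝ)| ≤ |(r : ℝ)| * r.den := le_mul_of_one_le_right (abs_nonneg _) hd
    _ = (r.num.natAbs : ℝ) := abs_cast_mul_den r
    _ ≤ (2 : ℝ) ^ (encodeRat r).length := by exact_mod_cast (natAbs_num_lt_two_pow r).le

/-- **`2^{-|code r|} ≤ |r|` for `r ≠ 0`.** [folklore] -/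
theorem two_pow_inv_le_abs_cast {r : ℚ} (hr : r ≠ 0) : (2⁻¹ : ℝ) ^ (encodeRat r).length ≤ |(r : ℝ)| := by
  have hd0 : (0 : ℝ) < r.den := by exact_mod_cast r.den_pos
  have hnum : (1 : ℝ) ≤ (r.num.natAbs : ℝ) := by
    have : r.num ≠ 0 := Rat.num_ne_zero.2 hr
    exact_mod_cast Int.natAbs_pos.2 this
  have hden : (r.den : ℝ) ≤ (2 : ℝ) ^ (encodeRat r).length := by exact_mod_cast (den_lt_two_pow r).le
  rw [inv_pow]
  calc ((2 : ℝ) ^ (encodeRat r).length)⁻¹ ≤ ((r.den : ℝ))⁻¹ := by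
        rw [inv_le_inv₀ (by positivity) hd0]; exact hden
    _ ≤ |(r : ℝ)| := by
        rw [inv_le_iff_one_le_mul₀ hd0, abs_cast_mul_den]; exact hnum

/-! ### The determinant -/

variable (I : LatticeInstance)

/-- **Leibniz–Hadamard**: `|det B| ≤ n! · (2^{|code B|})ⁿ` (entries `< 2^{|code B|}`).
[cite: MicciancioGoldwasser2002, Ch. 1 §1.1] -/
theorem detA_le : detA I ≤ I.n.factorial * (2 ^ I.encode.length) ^ I.n := by
  have hx : ∀ i j, AbsoluteValue.abs (I.basis i j) ≤ ((2 ^ I.encode.length : ℕ) : ℤ) := fun i j => by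
    rw [AbsoluteValue.abs_apply, Int.abs_eq_natAbs]
    exact_mod_cast (RegevRoutine.natAbs_entry_lt I i j).le
  have h := Matrix.det_le hx
  rw [AbsoluteValue.abs_apply, Fintype.card_fin, nsmul_eq_mul, Int.abs_eq_natAbs] at h
  unfold detA
  exact_mod_cast h

/-- **`|det B| ≤ 2^{2n|code B|}`** (`n! ≤ nⁿ ≤ 2^{n|code B|}` as `n ≤ |code B|`). [cite: MicciancioGoldwasser2002, Ch. 1 §1.2] -/
theorem detA_le_two_pow : detA I ≤ 2 ^ (2 * (I.n * I.encode.length)) := by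
  have hn : I.n ≤ 2 ^ I.encode.length :=
    (I.n_le_length_encode).trans (Nat.lt_two_pow_self).le
  have hf : I.n.factorial ≤ (2 ^ I.encode.length) ^ I.n :=
    (Nat.factorial_le_pow I.n).trans (Nat.pow_le_pow_left hn I.n)
  calc detA I ≤ I.n.factorial * (2 ^ I.encode.length) ^ I.n := detA_le I
    _ ≤ (2 ^ I.encode.length) ^ I.n * (2 ^ I.encode.length) ^ I.n := Nat.mul_le_mul_right _ hf
    _ = 2 ^ (2 * (I.n * I.encode.length)) := by rw [← pow_mul, ← pow_add]; congr 1; ring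

/-- The real form `(|det B| : ℝ) ≤ 2^{2n|code B|}`. [cite: MicciancioGoldwasser2002, Ch. 1 §1.2] -/
theorem cast_detA_le_two_pow : (detA I : ℝ) ≤ (2 : ℝ) ^ (2 * (I.n * I.encode.length)) := by
  exact_mod_cast detA_le_two_pow I

/-! ### The step ratio and the level radii -/

/-- **`1 ≤ θ(n)`** once `√n ≤ a(n) q(n)` (`n ≥ 1`). [cite: Regev2009, Theorem 3.1 (proof: "αp/√n ≥ 1")] -/
theorem one_le_stepRatio (a : ℕ → ℚ) (q : ℕ → ℕ) {n : ℕ} (hn : 0 < n) (h : Real.sqrt n ≤ (a n : ℝ) * q n) :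
    (1 : ℝ) ≤ ((stepRatio a q n : ℚ) : ℝ) := by
  have hs : 0 < Real.sqrt n := Real.sqrt_pos.2 (by exact_mod_cast hn)
  refine le_trans ?_ (le_stepRatio a q hn)
  rwa [le_div_iff₀ hs, one_mul]

/-- **`θ(n) ≤ 2 q(n)`** for `0 ≤ a(n) ≤ 1` (`n ≥ 1`). [folklore] -/
theorem stepRatio_le_two_mul (a : ℕ → ℚ) (q : ℕ → ℕ) {n : ℕ} (hn : 0 < n) (h0 : 0 ≤ a n) (h1 : a n ≤ 1) :
    ((stepRatio a q n : ℚ) : ℝ) ≤ 2 * q n := by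
  have hs1 : 1 ≤ Real.sqrt n := by
    rw [show (1 : ℝ) = Real.sqrt 1 by simp]
    exact Real.sqrt_le_sqrt (by exact_mod_cast hn)
  have ha : ((a n : ℚ) : ℝ) ≤ 1 := by exact_mod_cast h1
  have ha0 : (0 : ℝ) ≤ ((a n : ℚ) : ℝ) := by exact_mod_cast h0
  have hq0 : (0 : ℝ) ≤ q n := Nat.cast_nonneg _
  have h2 : 1 + 1 / (2 : ℝ) ^ n ≤ 2 := by
    have : 1 / (2 : ℝ) ^ n ≤ 1 := by
      rw [div_le_one (by positivity)]; exact one_le_pow₀ one_le_two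
    linarith
  calc ((stepRatio a q n : ℚ) : ℝ) ≤ (a n : ℝ) * q n / Real.sqrt n * (1 + 1 / (2 : ℝ) ^ n) := stepRatio_le a q hn h0
    _ ≤ 1 * q n / 1 * 2 := by
        refine mul_le_mul ?_ h2 (by positivity) (by positivity)
        exact div_le_div₀ (by positivity) (mul_le_mul_of_nonneg_right ha hq0) one_pos hs1
    _ = 2 * q n := by ring

/-- **`r ≤ ρ_k`** for `θ ≥ 1`, `r ≥ 0`. [cite: Regev2009, Theorem 3.1 (proof: "rᵢ ≥ r")] -/
theorem le_levelRadius {t r : ℝ} (ht : 1 ≤ t) (hr : 0 ≤ r) (L k : ℕ) : r ≤ levelRadius t L r k := by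
  unfold levelRadius
  exact le_mul_of_one_le_left hr (one_le_pow₀ ht)

/-- **`ρ_k ≤ Θ^L r`** for `0 ≤ θ ≤ Θ`, `1 ≤ Θ`, `r ≥ 0`. [cite: Regev2009, Theorem 3.1 (proof)] -/
theorem levelRadius_le_pow_mul {t r Θ : ℝ} (h0 : 0 ≤ t) (ht : t ≤ Θ) (h1 : 1 ≤ Θ) (hr : 0 ≤ r) (L k : ℕ) :
    levelRadius t L r k ≤ Θ ^ L * r := by
  unfold levelRadius
  exact mul_le_mul_of_nonneg_right ((pow_le_pow_left₀ h0 ht _).trans (pow_le_pow_right₀ h1 (Nat.sub_le L k))) hr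

/-! ### The stage width -/

/-- **`t ≤ ρ`** for `aq ≥ 2√n` (`n ≥ 1`, `ρ ≥ 0`): `√2 ρ √n/(aq) ≤ ρ/√2 ≤ ρ`. [cite: Regev2009, Lemma 3.14 (proof)] -/
theorem tW_le_self {aq d : ℝ} {n : ℕ} (hn : 0 < n) (haq : 2 * Real.sqrt n ≤ aq) (hd : 0 ≤ d) : tW aq d n ≤ d := by
  have hs : 0 < Real.sqrt n := Real.sqrt_pos.2 (by exact_mod_cast hn)
  have haq0 : 0 < aq := lt_of_lt_of_le (by positivity) haq
  have h2 : Real.sqrt 2 ≤ 2 := by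
    rw [show (2 : ℝ) = Real.sqrt (2 ^ 2) by rw [Real.sqrt_sq (by norm_num : (0:ℝ) ≤ 2)]]
    exact Real.sqrt_le_sqrt (by norm_num)
  unfold tW
  rw [div_le_iff₀ haq0]
  calc Real.sqrt 2 * d * Real.sqrt n ≤ 2 * d * Real.sqrt n := by gcongr
    _ = d * (2 * Real.sqrt n) := by ring
    _ ≤ d * aq := mul_le_mul_of_nonneg_left haq hd

/-- **`ρ/(aq) ≤ t`** (`n ≥ 1`, `ρ ≥ 0`, `aq > 0`): `√2 √n ≥ 1`. [cite: Regev2009, Lemma 3.14 (proof)] -/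
theorem div_le_tW {aq d : ℝ} {n : ℕ} (hn : 0 < n) (haq : 0 < aq) (hd : 0 ≤ d) : d / aq ≤ tW aq d n := by
  have hs1 : 1 ≤ Real.sqrt n := by
    rw [show (1 : ℝ) = Real.sqrt 1 by simp]
    exact Real.sqrt_le_sqrt (by exact_mod_cast hn)
  have h21 : 1 ≤ Real.sqrt 2 := by
    rw [show (1 : ℝ) = Real.sqrt 1 by simp]
    exact Real.sqrt_le_sqrt (by norm_num)
  unfold tW
  refine div_le_div_of_nonneg_right ?_ haq.le
  calc d = 1 * d * 1 := by ring
    _ ≤ Real.sqrt 2 * d * Real.sqrt n := by gcongr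

/-- **The window of the stage width**: for `2√n ≤ aq ≤ 2^{b_q}`, `1 ≤ θ ≤ 2^{b_q+1}`, `2^{-L_r} ≤ r ≤ 2^{L_r}`,
the width of the stage with radius `ρ_k = θ^{L-k} r` satisfies `2^{-(L_r+b_q)} ≤ t ≤ 2^{(b_q+1)L + L_r}`.
[cite: Regev2009, Lemma 3.14 (proof: "2^{poly(n)}-bounded quantities")] -/
theorem tW_window {aq θ r : ℝ} {n L k Lr bq : ℕ} (hn : 0 < n) (haq2 : 2 * Real.sqrt n ≤ aq) (haq : aq ≤ (2 : ℝ) ^ bq)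
    (hθ1 : 1 ≤ θ) (hθ : θ ≤ (2 : ℝ) ^ (bq + 1)) (hr' : (2⁻¹ : ℝ) ^ Lr ≤ r) (hr : r ≤ (2 : ℝ) ^ Lr) :
    (2⁻¹ : ℝ) ^ (Lr + bq) ≤ tW aq (levelRadius θ L r k) n ∧ tW aq (levelRadius θ L r k) n ≤ (2 : ℝ) ^ ((bq + 1) * L + Lr) := by
  have hs : 0 < Real.sqrt n := Real.sqrt_pos.2 (by exact_mod_cast hn)
  have haq0 : 0 < aq := lt_of_lt_of_le (by positivity) haq2
  have hr0 : 0 ≤ r := le_trans (by positivity) hr'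
  have hρ0 : 0 ≤ levelRadius θ L r k := by unfold levelRadius; positivity
  constructor
  · calc (2⁻¹ : ℝ) ^ (Lr + bq) = (2⁻¹ : ℝ) ^ Lr / (2 : ℝ) ^ bq := by rw [pow_add, inv_pow, inv_pow, div_eq_mul_inv]
      _ ≤ r / aq := div_le_div₀ hr0 hr' haq0 haq
      _ ≤ levelRadius θ L r k / aq := div_le_div_of_nonneg_right (le_levelRadius hθ1 hr0 L k) haq0.le
      _ ≤ _ := div_le_tW hn haq0 hρ0
  · calc tW aq (levelRadius θ L r k) n ≤ levelRadius θ L r k := tW_le_self hn haq2 hρ0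
      _ ≤ ((2 : ℝ) ^ (bq + 1)) ^ L * r := levelRadius_le_pow_mul (zero_le_one.trans hθ1) hθ (one_le_pow₀ one_le_two) hr0 L k
      _ ≤ ((2 : ℝ) ^ (bq + 1)) ^ L * (2 : ℝ) ^ Lr := mul_le_mul_of_nonneg_left hr (by positivity)
      _ = (2 : ℝ) ^ ((bq + 1) * L + Lr) := by rw [← pow_mul, ← pow_add]

end SamplerRegs

end Regev2009

end Literature.Computability.Cryptography

end
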